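import Summits.HodgeConjecture.HodgeConjecture.Theses.HeckePrymWeil
import Literature.AlgebraicGeometry.HodgeTheory.LefschetzOneOneHolds
import Literature.AlgebraicGeometry.HodgeTheory.AbelianLowDimensionHodgeConjecture
import Literature.AlgebraicGeometry.HodgeTheory.IsoTransport
import Literature.AlgebraicGeometry.Motives.AbelianVarietyProjectiveChart

/-!
# Route HeckePrymWeil — `WeilVariationalHodge` (stmt-HodgeConjecture-14497): the low rungs `M = 1, 2`

The crux `HeckePrymWeil.WeilVariationalHodge` (Grothendieck's variational Hodge statement for
fibrewise-rational `(M, M)` global classes along smooth projective families of abelian `2M`-folds with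
`√-p`-multiplication, all `M ≥ 1`) needs NO transport in its two lowest rungs, because there the Hodge
conjecture itself is known on every fibre:

* `M = 1` — rational `(1,1)`-classes on the (surface) fibres are algebraic by Lefschetz's theorem on
  `(1,1)`-classes, proved in the tree (`lefschetzOneOne_rational_holds`, Voisin I Thm. 11.30 with
  Kodaira–Serre and GAGA): `variationalHodge_degree_two` (along ANY smooth projective family),
  `weilVariationalHodge_rung_one` (the crux with `M := 1`, literally), `weilVariationalHodge_iff_two_le`
  (**crux ⟺ its restriction to `2 ≤ M`**, unconditionally);
* `M = 2` — every fibre is isomorphic to an abelian FOURFOLD, and the Hodge conjecture holds for complex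
  abelian varieties of dimension `≤ 5` (Markman 2025, arXiv:2509.23403 Cor. 1.3 = Moonen–Zarhin +
  Ramón Marí + Tankeev + the algebraicity of the Weil classes on abelian fourfolds of Weil type for every
  imaginary quadratic field and every discriminant, arXiv:2502.03415; the tree's named fact
  `Markman2025_hodgeClasses_algebraic_abelian_dim_le_five`, an unrefereed claim in print, taken here as a
  HYPOTHESIS): `weilVariationalHodge_rung_two_of_markman` (the crux with `M := 2`, moved across the fibre
  chart `A'.X ≅ 𝒳_s` by `forall_hodgeClass_mem_algebraicClasses_iff_of_iso`),
  `weilVariationalHodge_iff_three_le_of_markman` (**granted that fact, crux ⟺ its restriction to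
  `3 ≤ M`**: abelian fibres of dimension `2M ≥ 6`, where the Hodge conjecture for abelian varieties is
  open in print — Weil classes on sixfolds of non-split Weil type).

So the open content of the crux starts at `M = 3`; the planner may raise `1 ≤ M` to `2 ≤ M` for free and
to `3 ≤ M` modulo Markman's Cor. 1.3. Lead c2 of line `Sketch`, cycle 2; sorry-free, no new definitions.
-/

noncomputable section

-- every declaration of this problem lives in `Summit.HodgeConjecture.HodgeConjecture.…` (summit = sub-problem)
set_option linter.dupNamespace false

open CategoryTheory AlgebraicGeometry
open Literature.AlgebraicGeometry.Motives Literature.AlgebraicGeometry.HodgeTheory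
open Summit.HodgeConjecture.HodgeConjecture.Theses

namespace Summit.HodgeConjecture.HodgeConjecture.Theorems

/-! ### Rung `M = 1`: Lefschetz `(1,1)` fibrewise (unconditional) -/

/-- **Variational Hodge in degree `2` is Lefschetz `(1,1)` fibrewise.** For a smooth projective family
`f : 𝒳 ⟶ S` of relative dimension `n` over `ℂ` and a global class `W ∈ H²(𝒳(ℂ); ℂ)` whose restriction to
every fibre is rational of Hodge type `(1,1)`, the restriction `W|_{𝒳_s}` is algebraic on EVERY fibre —
by Lefschetz's theorem on `(1,1)`-classes (`lefschetzOneOne_rational_holds`) applied to the smooth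
projective fibre `𝒳_s` (`IsSmoothProjectiveFamily.isSmoothProjective`). No anchor fibre is needed.
[cite: VoisinHodgeI2002, Thm. 11.30 and §11.3.3] [cite: CharlesSchnell2014Notes, §11.3] -/
theorem variationalHodge_degree_two {n : ℕ} {𝒳 S : SchemeOver ℂ} (f : 𝒳 ⟶ S)
    (hf : IsSmoothProjectiveFamily f n) (W : complexBetti 𝒳 (2 * 1))
    (hW : ∀ s : ComplexPoints S, IsRationalClass (complexBetti.map (fiberι f s) (2 * 1) W) ∧
      IsOfHodgeType n (fiberOver f s) (2 * 1) 1 1 (complexBetti.map (fiberι f s) (2 * 1) W))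
    (s : ComplexPoints S) :
    complexBetti.map (fiberι f s) (2 * 1) W ∈ algebraicClasses (fiberOver f s) 1 :=
  lefschetzOneOne_rational_holds (hf.isSmoothProjective s) _ (hW s).1 (hW s).2

/-- **The rung `M = 1` of the crux `HeckePrymWeil.WeilVariationalHodge` holds** — literally the crux with
`M` instantiated to `1` (families of abelian surfaces with `φ' ≫ φ' = -p`; global degree-`2` classes,
fibrewise rational of type `(1,1)`): by `variationalHodge_degree_two`; the `√-p`-structure, the anchor
fibre `s₀`, irreducibility and smoothness of the base are all idle here.
[cite: VoisinHodgeI2002, Thm. 11.30 and §11.3.3] -/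
theorem weilVariationalHodge_rung_one :
    ∀ p : ℕ, p.Prime → p % 4 = 3 → 7 ≤ p → ∀ ⦃𝒳 S : SchemeOver ℂ⦄ (f : 𝒳 ⟶ S),
      IsSmoothProjectiveFamily f (2 * 1) → IrreducibleSpace S.left → AlgebraicGeometry.Smooth S.hom →
      ∀ (W : complexBetti 𝒳 (2 * 1)),
      (∀ s : ComplexPoints S, IsRationalClass (complexBetti.map (fiberι f s) (2 * 1) W) ∧
        IsOfHodgeType (2 * 1) (fiberOver f s) (2 * 1) 1 1 (complexBetti.map (fiberι f s) (2 * 1) W)) →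
      (∀ s : ComplexPoints S, ∃ (A' : AbelianVariety ℂ) (φ' : A' ⟶ A'), A'.dim = (2 * 1) ∧
        φ' ≫ φ' = -((p : ℤ) • 𝟙 A') ∧ Nonempty (A'.X ≅ fiberOver f s)) →
      (∃ s₀ : ComplexPoints S,
        complexBetti.map (fiberι f s₀) (2 * 1) W ∈ algebraicClasses (fiberOver f s₀) 1) →
      ∀ s : ComplexPoints S, complexBetti.map (fiberι f s) (2 * 1) W ∈ algebraicClasses (fiberOver f s) 1 :=
  fun _ _ _ _ _ _ f hf _ _ W hW _ _ s => variationalHodge_degree_two f hf W hW s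

/-- **The crux is equivalent to its restriction to `M ≥ 2`.** `HeckePrymWeil.WeilVariationalHodge`
quantifies over all `M ≥ 1`; since its rung `M = 1` holds outright (`weilVariationalHodge_rung_one`,
Lefschetz `(1,1)`), the crux is equivalent to the same statement with `1 ≤ M` replaced by `2 ≤ M`
(abelian fibres of dimension `2M ≥ 4`, classes of degree `2M ≥ 4`). [folklore] -/
theorem weilVariationalHodge_iff_two_le :
    HeckePrymWeil.WeilVariationalHodge ↔
    ∀ p : ℕ, p.Prime → p % 4 = 3 → 7 ≤ p → ∀ M : ℕ, 2 ≤ M → ∀ ⦃𝒳 S : SchemeOver ℂ⦄ (f : 𝒳 ⟶ S),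
      IsSmoothProjectiveFamily f (2 * M) → IrreducibleSpace S.left → AlgebraicGeometry.Smooth S.hom →
      ∀ (W : complexBetti 𝒳 (2 * M)),
      (∀ s : ComplexPoints S, IsRationalClass (complexBetti.map (fiberι f s) (2 * M) W) ∧
        IsOfHodgeType (2 * M) (fiberOver f s) (2 * M) M M (complexBetti.map (fiberι f s) (2 * M) W)) →
      (∀ s : ComplexPoints S, ∃ (A' : AbelianVariety ℂ) (φ' : A' ⟶ A'), A'.dim = (2 * M) ∧
        φ' ≫ φ' = -((p : ℤ) • 𝟙 A') ∧ Nonempty (A'.X ≅ fiberOver f s)) →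
      (∃ s₀ : ComplexPoints S,
        complexBetti.map (fiberι f s₀) (2 * M) W ∈ algebraicClasses (fiberOver f s₀) M) →
      ∀ s : ComplexPoints S, complexBetti.map (fiberι f s) (2 * M) W ∈ algebraicClasses (fiberOver f s) M := by
  unfold HeckePrymWeil.WeilVariationalHodge
  constructor
  · intro hV p hp hp4 hp7 M hM
    exact hV p hp hp4 hp7 M (by omega)
  · intro h2 p hp hp4 hp7 M hM
    by_cases hM1 : M = 1
    · subst hM1
      exact weilVariationalHodge_rung_one p hp hp4 hp7
    · exact h2 p hp hp4 hp7 M (by omega)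

/-! ### Rung `M = 2`: the Hodge conjecture for abelian fourfolds (modulo Markman 2025, Cor. 1.3) -/

/-- **The rung `M = 2` of the crux holds, granted the Hodge conjecture for complex abelian varieties of
dimension `≤ 5`** (the named fact `Markman2025_hodgeClasses_algebraic_abelian_dim_le_five`, Markman,
arXiv:2509.23403 Cor. 1.3 — taken as a hypothesis, so this is a CONDITIONAL result): every fibre `𝒳_s`
is isomorphic to (the scheme of) an abelian fourfold `A'` (`A'.dim = 2 * 2`), smooth projective of
dimension `A'.dim` (`AbelianVariety.isSmoothProjective_holds`), on which every rational `(2,2)`-class is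
algebraic by the fact; the three predicates move across the chart `A'.X ≅ 𝒳_s`
(`forall_hodgeClass_mem_algebraicClasses_iff_of_iso`). Again no transport, no anchor and no `√-p` are
used. [claim: Markman2025SurveySecant, status: under-review] -/
theorem weilVariationalHodge_rung_two_of_markman
    (hMk : Markman2025_hodgeClasses_algebraic_abelian_dim_le_five) :
    ∀ p : ℕ, p.Prime → p % 4 = 3 → 7 ≤ p → ∀ ⦃𝒳 S : SchemeOver ℂ⦄ (f : 𝒳 ⟶ S),
      IsSmoothProjectiveFamily f (2 * 2) → IrreducibleSpace S.left → AlgebraicGeometry.Smooth S.hom →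
      ∀ (W : complexBetti 𝒳 (2 * 2)),
      (∀ s : ComplexPoints S, IsRationalClass (complexBetti.map (fiberι f s) (2 * 2) W) ∧
        IsOfHodgeType (2 * 2) (fiberOver f s) (2 * 2) 2 2 (complexBetti.map (fiberι f s) (2 * 2) W)) →
      (∀ s : ComplexPoints S, ∃ (A' : AbelianVariety ℂ) (φ' : A' ⟶ A'), A'.dim = (2 * 2) ∧
        φ' ≫ φ' = -((p : ℤ) • 𝟙 A') ∧ Nonempty (A'.X ≅ fiberOver f s)) →
      (∃ s₀ : ComplexPoints S,
        complexBetti.map (fiberι f s₀) (2 * 2) W ∈ algebraicClasses (fiberOver f s₀) 2) →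
      ∀ s : ComplexPoints S, complexBetti.map (fiberι f s) (2 * 2) W ∈ algebraicClasses (fiberOver f s) 2 := by
  intro p _ _ _ 𝒳 S f _ _ _ W hW hA _ s
  obtain ⟨A', _, hdim, -, ⟨e⟩⟩ := hA s
  -- the Hodge conjecture in degree `4` on the abelian fourfold `A'` (Markman's Cor. 1.3, `dim A' = 4 ≤ 5`)
  have hA' : ∀ c : complexBetti A'.X (2 * 2), IsRationalClass c → IsOfHodgeType (2 * 2) A'.X (2 * 2) 2 2 c →
      c ∈ algebraicClasses A'.X 2 := by
    have hsp : IsSmoothProjective A'.dim A'.X := AbelianVariety.isSmoothProjective_holds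
    have h := hMk A' (by omega) hsp 2
    rw [hdim] at h
    exact h
  -- move it across the chart `e : A'.X ≅ 𝒳_s` and apply it to `W|_{𝒳_s}`
  exact (forall_hodgeClass_mem_algebraicClasses_iff_of_iso e 2).1 hA' _ (hW s).1 (hW s).2

/-- **Granted the Hodge conjecture for abelian varieties of dimension `≤ 5` (Markman 2025, Cor. 1.3),
the crux is equivalent to its restriction to `M ≥ 3`** (abelian fibres of dimension `2M ≥ 6`): the rungs
`M = 1` (`weilVariationalHodge_rung_one`, unconditional) and `M = 2`
(`weilVariationalHodge_rung_two_of_markman`) hold fibre by fibre. This is where the open problem starts: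
in print the Hodge conjecture for abelian varieties is open from dimension `6` on (Weil classes on
sixfolds of non-split Weil type). [claim: Markman2025SurveySecant, status: under-review] -/
theorem weilVariationalHodge_iff_three_le_of_markman
    (hMk : Markman2025_hodgeClasses_algebraic_abelian_dim_le_five) :
    HeckePrymWeil.WeilVariationalHodge ↔
    ∀ p : ℕ, p.Prime → p % 4 = 3 → 7 ≤ p → ∀ M : ℕ, 3 ≤ M → ∀ ⦃𝒳 S : SchemeOver ℂ⦄ (f : 𝒳 ⟶ S),
      IsSmoothProjectiveFamily f (2 * M) → IrreducibleSpace S.left → AlgebraicGeometry.Smooth S.hom →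
      ∀ (W : complexBetti 𝒳 (2 * M)),
      (∀ s : ComplexPoints S, IsRationalClass (complexBetti.map (fiberι f s) (2 * M) W) ∧
        IsOfHodgeType (2 * M) (fiberOver f s) (2 * M) M M (complexBetti.map (fiberι f s) (2 * M) W)) →
      (∀ s : ComplexPoints S, ∃ (A' : AbelianVariety ℂ) (φ' : A' ⟶ A'), A'.dim = (2 * M) ∧
        φ' ≫ φ' = -((p : ℤ) • 𝟙 A') ∧ Nonempty (A'.X ≅ fiberOver f s)) →
      (∃ s₀ : ComplexPoints S,
        complexBetti.map (fiberι f s₀) (2 * M) W ∈ algebraicClasses (fiberOver f s₀) M) →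
      ∀ s : ComplexPoints S, complexBetti.map (fiberι f s) (2 * M) W ∈ algebraicClasses (fiberOver f s) M := by
  unfold HeckePrymWeil.WeilVariationalHodge
  constructor
  · intro hV p hp hp4 hp7 M hM
    exact hV p hp hp4 hp7 M (by omega)
  · intro h3 p hp hp4 hp7 M hM
    obtain rfl | rfl | hM3 : M = 1 ∨ M = 2 ∨ 3 ≤ M := by omega
    · exact weilVariationalHodge_rung_one p hp hp4 hp7
    · exact weilVariationalHodge_rung_two_of_markman hMk p hp hp4 hp7
    · exact h3 p hp hp4 hp7 M hM3

end Summit.HodgeConjecture.HodgeConjecture.Theorems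

end
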